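import Mathlib.Analysis.SpecialFunctions.Log.Basic
import Mathlib.Analysis.Complex.ExponentialBounds
import Summits.AnomalousDissipation.AnomalousDissipation.Theorems.LandauJetArenaLandauOverDissipationEnergy
import Summits.AnomalousDissipation.AnomalousDissipation.Theorems.LandauJetArenaLandauOverDissipationGradient
import Summits.AnomalousDissipation.AnomalousDissipation.Theses.LandauJetArena
import HarnessLib

/-!
# Route LandauJetArena (AnomalousDissipation) — item `LandauOverDissipation` (stmt-AnomalousDissipation-1548)

Settles the support item `LandauOverDissipation` of route `LandauJetArena`: for Karch–Pilarczyk's Landau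
family `v_c` (axis `e₁`, `ν = 1`; Karch–Pilarczyk 2011 (2.1), the expression inlined in the item, equal
off the origin to the tree's `Literature.Analysis.FluidPDE.landauAxisField e₁ c` by
`landauAxisField_single_zero`) and the point force `b(c) = 8πc/(3(c²−1))(2+6c²−3c(c²−1)log((c+1)/(c−1)))`
(Karch–Pilarczyk 2011 (2.2)), there are `C₁ > 0`, `C₂` with, for all `c ∈ (1,2)`,
`∫_{1<|x|<2} |v_c|² ≤ C₂ b(c)` and `∫_{1<|x|<2} |∇v_c|²_F ≥ C₁ b(c)²`.

Contents:
* `force_lower`, `force_upper`, `force_pos` — `π/(c−1) ≤ b(c) ≤ 50π/(c−1)` on `(1,2)` from `log x ≤ x − 1`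
  and `log 2 < 0.6932` (`sub_one_mul_log_ratio_le`: `(c−1) log((c+1)/(c−1)) ≤ 6/5`);
* `landauOverDissipation_proof` — the item, with `C₁ = 1/(38880·2500·π²)`, `C₂ = 512π`, assembled from
  `shell_energy_le` (`∫_A|v_c|² ≤ 512π²/(c−1)`, file `…Energy.lean`) and `shell_gradient_ge`
  (`∫_A|∇v_c|²_F ≥ 1/(38880(c−1)²)`, file `…Gradient.lean`); the inlined field is replaced by
  `landauAxisField e₁ c` on the shell (`setIntegral_congr_fun`, `Filter.EventuallyEq.fderiv_eq`).

So `E_A ≍ b` while `D_A ≍ b²`: the laminar needle violates the zeroth-law scaling upward, as the route's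
rationale (L) asserts. Elementary real analysis; constants deliberately crude. [folklore]
-/

-- every `Summits/AnomalousDissipation/AnomalousDissipation/Theorems` file repeats the sub-problem name
set_option linter.dupNamespace false

noncomputable section

namespace Summit.AnomalousDissipation.AnomalousDissipation.Theorems.LandauOverDissipation

open MeasureTheory Real Set WithLp
open Literature.Analysis.FluidPDE

/-- `0 < log((c+1)/(c−1))` for `1 < c`. [folklore] -/
theorem log_ratio_pos {c : ℝ} (hc : 1 < c) : 0 < Real.log ((c + 1) / (c - 1)) := by
  apply Real.log_pos
  rw [one_lt_div (by linarith)]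
  linarith

/-- `(c − 1) log((c+1)/(c−1)) ≤ 6/5` for `1 < c < 2` (from `log x ≤ x − 1` and `log 2 < 0.6932`). [folklore] -/
theorem sub_one_mul_log_ratio_le {c : ℝ} (hc1 : 1 < c) (hc2 : c < 2) :
    (c - 1) * Real.log ((c + 1) / (c - 1)) ≤ 6 / 5 := by
  have hε : 0 < c - 1 := by linarith
  have hL : Real.log ((c + 1) / (c - 1)) = Real.log (c + 1) - Real.log (c - 1) :=
    Real.log_div (by linarith) hε.ne'
  have h1 : Real.log (c + 1) ≤ Real.log 2 + (c - 1) / 2 := by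
    have h := Real.log_le_sub_one_of_pos (show 0 < (c + 1) / 2 by linarith)
    have h' : Real.log ((c + 1) / 2) = Real.log (c + 1) - Real.log 2 :=
      Real.log_div (by linarith) (by norm_num)
    rw [h'] at h
    linarith
  have h2 : -Real.log (c - 1) ≤ 1 / (c - 1) - 1 := by
    have h := Real.log_le_sub_one_of_pos (show 0 < (c - 1)⁻¹ by positivity)
    rw [Real.log_inv] at h
    simpa [one_div] using h
  have h3 : (c - 1) * (-Real.log (c - 1)) ≤ 1 - (c - 1) := by
    have := mul_le_mul_of_nonneg_left h2 hε.le
    have h4 : (c - 1) * (1 / (c - 1) - 1) = 1 - (c - 1) := by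
      field_simp
    linarith [h4]
  have hlog2 := Real.log_two_lt_d9
  rw [hL, mul_sub]
  have h5 : (c - 1) * Real.log (c + 1) ≤ (c - 1) * (Real.log 2 + (c - 1) / 2) :=
    mul_le_mul_of_nonneg_left h1 hε.le
  nlinarith [mul_pos hε hε]

/-- The bracket `g(c) = 2 + 6c² − 3c(c²−1) log((c+1)/(c−1))` is at least `4/5` on `(1,2)`. [folklore] -/
theorem bracket_ge {c : ℝ} (hc1 : 1 < c) (hc2 : c < 2) :
    4 / 5 ≤ 2 + 6 * c ^ 2 - 3 * c * (c ^ 2 - 1) * Real.log ((c + 1) / (c - 1)) := by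
  have h := sub_one_mul_log_ratio_le hc1 hc2
  have hL := log_ratio_pos hc1
  set L := Real.log ((c + 1) / (c - 1))
  have hcc : 0 ≤ 3 * c * (c + 1) := by positivity
  have h1 : 3 * c * (c ^ 2 - 1) * L = 3 * c * (c + 1) * ((c - 1) * L) := by ring
  rw [h1]
  have h2 : 3 * c * (c + 1) * ((c - 1) * L) ≤ 3 * c * (c + 1) * (6 / 5) :=
    mul_le_mul_of_nonneg_left h hcc
  nlinarith

/-- The bracket `g(c)` is at most `26` on `(1,2)`. [folklore] -/
theorem bracket_le {c : ℝ} (hc1 : 1 < c) (hc2 : c < 2) :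
    2 + 6 * c ^ 2 - 3 * c * (c ^ 2 - 1) * Real.log ((c + 1) / (c - 1)) ≤ 26 := by
  have hL := log_ratio_pos hc1
  have h1 : 0 ≤ 3 * c * (c ^ 2 - 1) * Real.log ((c + 1) / (c - 1)) := by
    have : 0 ≤ 3 * c * (c ^ 2 - 1) := by nlinarith
    positivity
  nlinarith

/-- Lower bound `π/(c−1) ≤ b(c)` for the Karch–Pilarczyk force on `(1,2)` (Karch–Pilarczyk 2011, (2.2):
`b(c) → ∞` as `c → 1⁺`, made quantitative). [folklore] -/
theorem force_lower {c : ℝ} (hc1 : 1 < c) (hc2 : c < 2) :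
    Real.pi / (c - 1) ≤ 8 * Real.pi * c / (3 * (c ^ 2 - 1)) *
      (2 + 6 * c ^ 2 - 3 * c * (c ^ 2 - 1) * Real.log ((c + 1) / (c - 1))) := by
  have hg := bracket_ge hc1 hc2
  set g := 2 + 6 * c ^ 2 - 3 * c * (c ^ 2 - 1) * Real.log ((c + 1) / (c - 1))
  have hε : 0 < c - 1 := by linarith
  have hc21 : c ^ 2 - 1 = (c - 1) * (c + 1) := by ring
  rw [hc21, div_le_iff₀ hε]
  have h1 : 8 * Real.pi * c / (3 * ((c - 1) * (c + 1))) * g * (c - 1) =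
      Real.pi * (8 * c * g / (3 * (c + 1))) := by
    field_simp
  rw [h1]
  have h2 : 1 ≤ 8 * c * g / (3 * (c + 1)) := by
    rw [le_div_iff₀ (by positivity)]
    nlinarith
  nlinarith [Real.pi_pos]

/-- Upper bound `b(c) ≤ 50π/(c−1)` for the Karch–Pilarczyk force on `(1,2)`. [folklore] -/
theorem force_upper {c : ℝ} (hc1 : 1 < c) (hc2 : c < 2) :
    8 * Real.pi * c / (3 * (c ^ 2 - 1)) *
      (2 + 6 * c ^ 2 - 3 * c * (c ^ 2 - 1) * Real.log ((c + 1) / (c - 1))) ≤ 50 * Real.pi / (c - 1) := by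
  have hg := bracket_le hc1 hc2
  have hg' := bracket_ge hc1 hc2
  set g := 2 + 6 * c ^ 2 - 3 * c * (c ^ 2 - 1) * Real.log ((c + 1) / (c - 1))
  have hε : 0 < c - 1 := by linarith
  have hc21 : c ^ 2 - 1 = (c - 1) * (c + 1) := by ring
  rw [hc21, le_div_iff₀ hε]
  have h1 : 8 * Real.pi * c / (3 * ((c - 1) * (c + 1))) * g * (c - 1) =
      Real.pi * (8 * c * g / (3 * (c + 1))) := by
    field_simp
  rw [h1]
  have h2 : 8 * c * g / (3 * (c + 1)) ≤ 50 := by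
    rw [div_le_iff₀ (by positivity)]
    nlinarith
  nlinarith [Real.pi_pos]

/-- Positivity `0 < b(c)` of the Karch–Pilarczyk force on `(1,2)`. [folklore] -/
theorem force_pos {c : ℝ} (hc1 : 1 < c) (hc2 : c < 2) :
    0 < 8 * Real.pi * c / (3 * (c ^ 2 - 1)) *
      (2 + 6 * c ^ 2 - 3 * c * (c ^ 2 - 1) * Real.log ((c + 1) / (c - 1))) := by
  have h := force_lower hc1 hc2
  have : 0 < Real.pi / (c - 1) := div_pos Real.pi_pos (by linarith)
  linarith


/-- **Item stmt-AnomalousDissipation-1548 (`LandauOverDissipation`).** For Karch–Pilarczyk's Landau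
family `v_c` (axis `e₁`, `ν = 1`) and force `b(c) = 8πc/(3(c²−1))(2+6c²−3c(c²−1)log((c+1)/(c−1)))`
there are `C₁ > 0`, `C₂` with, for all `c ∈ (1,2)`: shell energy `∫_A |v_c|² ≤ C₂ b(c)` and shell
dissipation `∫_A |∇v_c|²_F ≥ C₁ b(c)²` on `A = {1<|x|<2}`; here `C₁ = 1/(38880·2500·π²)`, `C₂ = 512π`.
Karch–Pilarczyk 2011 (2.1)–(2.2); elementary real analysis. [folklore] -/
theorem landauOverDissipation_proof :
    Summit.AnomalousDissipation.AnomalousDissipation.Theses.LandauJetArena.LandauOverDissipation := by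
  refine ⟨1 / (38880 * 2500 * π ^ 2), 512 * π, by positivity, fun c hc1 hc2 => ?_⟩
  beta_reduce
  have hc' : 1 < |c| := by rwa [abs_of_pos (by linarith)]
  have hε : 0 < c - 1 := by linarith
  have hne : ∀ x ∈ {x : EuclideanSpace ℝ (Fin 3) | 1 < ‖x‖ ∧ ‖x‖ < 2}, x ≠ 0 := by
    intro x hx h0
    rw [Set.mem_setOf_eq, h0, norm_zero] at hx
    linarith [hx.1]
  have hb0 := force_pos hc1 hc2
  have hbl := force_lower hc1 hc2
  have hbu := force_upper hc1 hc2
  refine ⟨?_, ?_⟩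
  · calc _ = ∫ x in {x : EuclideanSpace ℝ (Fin 3) | 1 < ‖x‖ ∧ ‖x‖ < 2},
            ‖landauAxisField (EuclideanSpace.single 0 1) c x‖ ^ 2 :=
          setIntegral_congr_fun measurableSet_shell fun x hx => by
            rw [landauAxisField_single_zero hc' (hne x hx)]
      _ ≤ 512 * π ^ 2 / (c - 1) := shell_energy_le hc1 hc2
      _ = 512 * π * (π / (c - 1)) := by ring
      _ ≤ _ := mul_le_mul_of_nonneg_left hbl (by positivity)
  · calc _ ≤ 1 / (38880 * 2500 * π ^ 2) * (50 * π / (c - 1)) ^ 2 :=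
          mul_le_mul_of_nonneg_left (pow_le_pow_left₀ hb0.le hbu 2) (by positivity)
      _ = 1 / (38880 * (c - 1) ^ 2) := by
          field_simp
          ring
      _ ≤ ∫ x in {x : EuclideanSpace ℝ (Fin 3) | 1 < ‖x‖ ∧ ‖x‖ < 2},
            frobeniusNormSq (fderiv ℝ (landauAxisField (EuclideanSpace.single 0 1) c) x) :=
          shell_gradient_ge hc1 hc2
      _ = _ := (setIntegral_congr_fun measurableSet_shell fun x hx => by
          congr 1
          exact Filter.EventuallyEq.fderiv_eq (Filter.eventuallyEq_of_mem (isOpen_ne.mem_nhds (hne x hx))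
            fun y hy => (landauAxisField_single_zero hc' hy).symm)).symm

end Summit.AnomalousDissipation.AnomalousDissipation.Theorems.LandauOverDissipation
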